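import Literature.Analysis.Fourier.BoasKacFourierSide
import Literature.Analysis.Fourier.FourierUniquenessL1

/-!
# The Boas–Kac factorisation, time side: sums of autocorrelations are autocorrelations (`C_c^∞` data)

The AUTOCORRELATION of `g : ℝ → ℂ` is `g ⋆ g̃`, `g̃(u) = conj (g (-u))`, i.e.
`(g ⋆ g̃)(x) = ∫ g(t) conj (g (t - x)) dt`, written here with Mathlib's `convolution` and `ContinuousLinearMap.mul`
(the spelling used by the Riemann-hypothesis sign-cone route).  Its Fourier transform is `|𝓕 g|²` (`fourier_autocorr`).

**Theorem** (`exists_smooth_autocorr_eq_sum`, Boas–Kac for smooth data [BoasKac1945, Thm 1]).  For finitely many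
`gᵢ ∈ C_c^∞(ℝ)` with `tsupport gᵢ ⊆ [-a, a]` there is ONE `f ∈ C_c^∞(ℝ)` with `tsupport f ⊆ [-a, a]` such that
`f ⋆ f̃ = Σᵢ gᵢ ⋆ g̃ᵢ` pointwise.  Hence the autocorrelations of `C_c^∞` functions supported in a fixed symmetric
interval form a convex cone, and the sign-cone statements over families `(gᵢ)_{i<k}` reduce to `k = 1`.

Proof: translate to `[0, 2a]`; take the `L²` factor `f°` of `BoasKac.exists_memLp_norm_sq_fourier_eq_sum`; its Fourier
transform is dominated by `Σᵢ |𝓕 gᵢ|`, a sum of Schwartz functions, so `f°` agrees a.e. with the smooth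
`x ↦ 𝓕(𝓕 f°)(-x)` (`exists_contDiff_ae_eq_of_fourier_moments`: duality against Schwartz test functions, no continuity of
`f°` needed), which vanishes off `[0, 2a]` by continuity; `𝓕 (f₁ ⋆ f̃₁) = |𝓕 f₁|² = Σᵢ |𝓕 gᵢ|² = 𝓕 (Σᵢ gᵢ ⋆ g̃ᵢ)` and
Fourier uniqueness plus continuity give equality everywhere; translate back (autocorrelation is translation invariant).
Not here: the `L²`-data time-side statement with continuity of `f ⋆ f̃`, positive-definite-function formulations,
uniqueness. [cite: BoasKac1945, Thm 1]
-/


noncomputable section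

open Filter MeasureTheory Set FourierTransform SchwartzMap
open _root_.Complex _root_.Real
open scoped ComplexConjugate Topology ContDiff Convolution

namespace Literature.Analysis.Fourier.BoasKac

/-- Local shorthand for the autocorrelation `g ⋆ g̃` in the sign-cone spelling. -/
local notation "acorr " g:arg =>
  MeasureTheory.convolution g (fun u => (starRingEnd ℂ) (g (-u))) (ContinuousLinearMap.mul ℂ ℂ)
    MeasureTheory.MeasureSpace.volume

/-! ## Fourier transform and translation invariance of autocorrelations -/

/-- `conj (𝐞 s) = 𝐞 (-s)` as complex numbers. [folklore] -/
theorem conj_fourierChar (s : ℝ) : conj ((𝐞 s : ℂ)) = (𝐞 (-s) : ℂ) := by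
  rw [Real.fourierChar_apply, Real.fourierChar_apply, ← Complex.exp_conj, map_mul, Complex.conj_ofReal,
    Complex.conj_I]
  congr 1; push_cast; ring

/-- The reflected conjugate `g̃(u) = conj (g(-u))` of an integrable function is integrable. [folklore] -/
theorem integrable_conj_neg {f : ℝ → ℂ} (hf : Integrable f) : Integrable fun u => conj (f (-u)) :=
  (Complex.conjLIE.toContinuousLinearEquiv.integrable_comp_iff).mpr hf.comp_neg

/-- `𝓕 g̃ = conj ∘ 𝓕 g`. [folklore] -/
theorem fourier_conj_neg (f : ℝ → ℂ) (ξ : ℝ) : 𝓕 (fun u => conj (f (-u))) ξ = conj (𝓕 f ξ) := by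
  rw [Real.fourier_real_eq, Real.fourier_real_eq, ← integral_conj,
    ← integral_neg_eq_self (fun v : ℝ => 𝐞 (-(v * ξ)) • conj (f (-v))) volume]
  refine integral_congr_ae (Eventually.of_forall fun v => ?_)
  simp only [neg_neg, Circle.smul_def, smul_eq_mul, map_mul, conj_fourierChar, neg_mul]

/-- **The Fourier transform of an autocorrelation is the squared modulus**:
`𝓕 (g ⋆ g̃)(ξ) = 𝓕 g(ξ) · conj (𝓕 g(ξ)) = |𝓕 g(ξ)|²`. [folklore] -/
theorem fourier_autocorr {f : ℝ → ℂ} (hf : Integrable f) (ξ : ℝ) :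
    𝓕 (acorr f) ξ = ((‖𝓕 f ξ‖ ^ 2 : ℝ) : ℂ) := by
  rw [Real.fourier_mul_convolution_eq hf (integrable_conj_neg hf), fourier_conj_neg, mul_conj, normSq_eq_norm_sq]

/-- Autocorrelation is translation invariant: `(g(· - c)) ⋆ (g(· - c))~ = g ⋆ g̃`. [folklore] -/
theorem autocorr_comp_sub (f : ℝ → ℂ) (c : ℝ) : acorr (fun x => f (x - c)) = acorr f := by
  funext x
  simp only [convolution_def, ContinuousLinearMap.mul_apply']
  rw [← integral_sub_right_eq_self (μ := volume) (fun t => f t * conj (f (-(x - t)))) c]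
  refine integral_congr_ae (Eventually.of_forall fun t => ?_)
  beta_reduce
  congr 3
  ring

/-- Autocorrelations of integrable functions are integrable. [folklore] -/
theorem integrable_autocorr {f : ℝ → ℂ} (hf : Integrable f) : Integrable (acorr f) :=
  hf.integrable_convolution _ (integrable_conj_neg hf)

/-- Autocorrelations of continuous compactly supported functions are continuous. [folklore] -/
theorem continuous_autocorr {f : ℝ → ℂ} (hf : Continuous f) (hcs : HasCompactSupport f) :
    Continuous (acorr f) := by
  refine HasCompactSupport.continuous_convolution_right _ ?_
    (hf.integrable_of_hasCompactSupport hcs).locallyIntegrable (Complex.continuous_conj.comp (hf.comp continuous_neg))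
  exact (hcs.comp_homeomorph (Homeomorph.neg ℝ)).comp_left (map_zero _)

/-! ## A smooth representative from Fourier moments -/

/-- `𝓕 (𝓕 φ) (x) = φ (-x)` for a Schwartz function. [folklore] -/
theorem fourier_fourier_schwartz (φ : 𝓢(ℝ, ℂ)) (x : ℝ) : 𝓕 (𝓕 (φ : ℝ → ℂ)) x = φ (-x) := by
  have h := congrFun (φ.continuous.fourierInv_fourier_eq φ.integrable
    (by simpa only [fourier_coe] using (𝓕 φ).integrable)) (-x)
  rwa [Real.fourierInv_eq_fourier_neg, neg_neg] at h

/-- **Smooth representative from Fourier moments.**  If `f ∈ L¹(ℝ)` and `ξ ↦ |ξ|ⁿ |𝓕 f(ξ)|` is integrable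
for every `n`, then `f` agrees a.e. with the `C^∞` function `x ↦ 𝓕(𝓕 f)(-x)`.  (Duality against Schwartz test
functions; no continuity of `f` is assumed.) [folklore] -/
theorem exists_contDiff_ae_eq_of_fourier_moments {f : ℝ → ℂ} (hf : Integrable f)
    (hmom : ∀ n : ℕ, Integrable (fun ξ : ℝ => ‖ξ‖ ^ n * ‖𝓕 f ξ‖)) :
    ∃ f₁ : ℝ → ℂ, ContDiff ℝ ∞ f₁ ∧ f₁ =ᵐ[volume] f := by
  have hFcont : Continuous (𝓕 f) :=
    VectorFourier.fourierIntegral_continuous Real.continuous_fourierChar (by exact continuous_inner) hf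
  have hFint : Integrable (𝓕 f) :=
    (integrable_norm_iff hFcont.aestronglyMeasurable).mp (by simpa using hmom 0)
  set f₁ : ℝ → ℂ := fun x => 𝓕 (𝓕 f) (-x) with hf₁
  have hsmooth : ContDiff ℝ ∞ f₁ :=
    (Real.contDiff_fourier (N := (⊤ : ℕ∞)) (fun n _ => hmom n)).comp contDiff_neg
  refine ⟨f₁, hsmooth, ?_⟩
  have hloc : LocallyIntegrable (f₁ - f) volume :=
    hsmooth.continuous.locallyIntegrable.sub hf.locallyIntegrable
  -- duality: `∫ ψ • f₁ = ∫ ψ • f` for every real test function `ψ`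
  have hzero := ae_eq_zero_of_integral_contDiff_smul_eq_zero hloc fun ψ hψ hψc => by
    -- the Schwartz test function `Ψ(x) = ψ(-x)` (complexified)
    have hΨcs : HasCompactSupport (fun x => (ψ (-x) : ℂ)) :=
      (hψc.comp_homeomorph (Homeomorph.neg ℝ)).comp_left (g := Complex.ofReal) Complex.ofReal_zero
    have hΨsm : ContDiff ℝ ∞ (fun x => (ψ (-x) : ℂ)) := (Complex.ofRealCLM.contDiff.comp hψ).comp contDiff_neg
    set Ψ : 𝓢(ℝ, ℂ) := hΨcs.toSchwartzMap hΨsm with hΨ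
    have hΨapply : ∀ x, Ψ x = (ψ (-x) : ℂ) := fun x => rfl
    have e1 : ∫ x, ψ x • f₁ x = ∫ y, Ψ y • 𝓕 (𝓕 f) y := by
      rw [← integral_neg_eq_self (fun y => Ψ y • 𝓕 (𝓕 f) y) volume]
      refine integral_congr_ae (Eventually.of_forall fun x => ?_)
      simp only [hΨapply, neg_neg, hf₁, Complex.real_smul, smul_eq_mul]
    have e2 : ∫ y, Ψ y • 𝓕 (𝓕 f) y = ∫ ξ, 𝓕 (Ψ : ℝ → ℂ) ξ • 𝓕 f ξ :=
      (Literature.Analysis.Fourier.integral_fourier_smul_eq_of_integrable Ψ hFint).symm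
    have e3 : ∫ ξ, 𝓕 (Ψ : ℝ → ℂ) ξ • 𝓕 f ξ = ∫ x, 𝓕 (𝓕 (Ψ : ℝ → ℂ)) x • f x := by
      have := Literature.Analysis.Fourier.integral_fourier_smul_eq_of_integrable (𝓕 Ψ) hf
      simpa only [fourier_coe] using this.symm
    have e4 : ∫ x, 𝓕 (𝓕 (Ψ : ℝ → ℂ)) x • f x = ∫ x, ψ x • f x := by
      refine integral_congr_ae (Eventually.of_forall fun x => ?_)
      simp only [fourier_fourier_schwartz, hΨapply, neg_neg, Complex.real_smul, smul_eq_mul]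
    have hint₁ : Integrable (fun x => ψ x • f₁ x) :=
      (hψ.continuous.smul hsmooth.continuous).integrable_of_hasCompactSupport hψc.smul_right
    obtain ⟨C, hC⟩ := hψ.continuous.bounded_above_of_compact_support hψc
    have hint₂ : Integrable (fun x => ψ x • f x) := by
      simp_rw [Complex.real_smul]
      exact hf.bdd_mul (Complex.continuous_ofReal.comp hψ.continuous).aestronglyMeasurable
        (Eventually.of_forall fun x => by simpa using hC x)
    simp_rw [Pi.sub_apply, smul_sub]
    rw [integral_sub hint₁ hint₂, e1, e2, e3, e4, sub_self]
  filter_upwards [hzero] with x hx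
  simpa [sub_eq_zero] using hx

/-- A continuous function a.e. equal to a function vanishing off a closed set `K` has `tsupport ⊆ K`.
[folklore] -/
theorem tsupport_subset_of_ae_eq {f₁ f : ℝ → ℂ} (hf₁ : Continuous f₁) (h : f₁ =ᵐ[volume] f) {K : Set ℝ}
    (hK : IsClosed K) (hf : ∀ x ∉ K, f x = 0) : tsupport f₁ ⊆ K := by
  have hae : f₁ =ᵐ[volume.restrict Kᶜ] (0 : ℝ → ℂ) := by
    rw [Filter.EventuallyEq, ae_restrict_iff' hK.isOpen_compl.measurableSet]
    filter_upwards [h] with x hx hxK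
    rw [hx, hf x hxK, Pi.zero_apply]
  have hU : EqOn f₁ 0 Kᶜ :=
    Measure.eqOn_open_of_ae_eq hae hK.isOpen_compl hf₁.continuousOn continuousOn_const
  exact closure_minimal (fun x hx => by_contra fun hxK => hx (hU hxK)) hK

/-- Fourier transforms of a.e. equal functions coincide. [folklore] -/
theorem fourier_congr_ae {u v : ℝ → ℂ} (h : u =ᵐ[volume] v) (ξ : ℝ) : 𝓕 u ξ = 𝓕 v ξ := by
  rw [Real.fourier_real_eq, Real.fourier_real_eq]
  exact integral_congr_ae (by filter_upwards [h] with x hx; rw [hx])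

/-- The Fourier transform of a finite sum of integrable functions. [folklore] -/
theorem fourier_finset_sum {ι : Type*} (s : Finset ι) {F : ι → ℝ → ℂ} (hF : ∀ i ∈ s, Integrable (F i)) (ξ : ℝ) :
    𝓕 (fun x => ∑ i ∈ s, F i x) ξ = ∑ i ∈ s, 𝓕 (F i) ξ := by
  simp only [Real.fourier_eq, Finset.smul_sum]
  rw [integral_finsetSum _ fun i hi => (Real.fourierIntegral_convergent_iff ξ).2 (hF i hi)]

/-- **Boas–Kac factorisation for smooth data.**  Finite sums of autocorrelations `gᵢ ⋆ g̃ᵢ` of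
`C_c^∞` functions with `tsupport gᵢ ⊆ [-a, a]` are single autocorrelations `f ⋆ f̃` of the same kind.
[cite: BoasKac1945, Thm 1] -/
theorem exists_smooth_autocorr_eq_sum {ι : Type*} [Fintype ι] {a : ℝ} (ha : 0 < a) (g : ι → ℝ → ℂ)
    (hg : ∀ i, ContDiff ℝ ∞ (g i)) (hgc : ∀ i, HasCompactSupport (g i))
    (hga : ∀ i, tsupport (g i) ⊆ Icc (-a) a) :
    ∃ f : ℝ → ℂ, ContDiff ℝ ∞ f ∧ HasCompactSupport f ∧ tsupport f ⊆ Icc (-a) a ∧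
      MeasureTheory.convolution f (fun u => (starRingEnd ℂ) (f (-u))) (ContinuousLinearMap.mul ℂ ℂ) volume =
        fun x => ∑ i, MeasureTheory.convolution (g i) (fun u => (starRingEnd ℂ) (g i (-u)))
          (ContinuousLinearMap.mul ℂ ℂ) volume x := by
  -- Step 0: translate to `[0, L]`, `L = 2a`
  set L : ℝ := 2 * a with hL
  have hLpos : 0 < L := by positivity
  set gs : ι → ℝ → ℂ := fun i x => g i (x - a) with hgs
  have hgs_smooth : ∀ i, ContDiff ℝ ∞ (gs i) := fun i => (hg i).comp (contDiff_id.sub contDiff_const)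
  have hgs_cs : ∀ i, HasCompactSupport (gs i) := fun i => (hgc i).comp_homeomorph (Homeomorph.subRight a)
  have hgs_cont : ∀ i, Continuous (gs i) := fun i => (hgs_smooth i).continuous
  have hgs_supp : ∀ i, ∀ x ∉ Icc 0 L, gs i x = 0 := by
    intro i x hx
    show g i (x - a) = 0
    refine image_eq_zero_of_notMem_tsupport fun h' => hx ?_
    have := hga i h'
    exact ⟨by linarith [this.1], by linarith [this.2]⟩
  have hgs_int : ∀ i, Integrable (gs i) := fun i => (hgs_cont i).integrable_of_hasCompactSupport (hgs_cs i)
  -- Step 1: the `L²` factor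
  obtain ⟨f0, hmem, hsupp0, hfour⟩ := exists_memLp_norm_sq_fourier_eq_sum hLpos gs hgs_cont hgs_supp
  have hf0int : Integrable f0 := memLp_one_iff_integrable.mp
    (hmem.mono_exponent_of_measure_support_ne_top (s := Icc 0 L) hsupp0 measure_Icc_lt_top.ne (by norm_num))
  -- Step 2: Fourier moments of `f0`, via the Schwartz functions `𝓕 gsᵢ`
  have hF0cont : Continuous (𝓕 f0) :=
    VectorFourier.fourierIntegral_continuous Real.continuous_fourierChar (by exact continuous_inner) hf0int
  have hdom : ∀ ξ, ‖𝓕 f0 ξ‖ ≤ ∑ i, ‖𝓕 (gs i) ξ‖ := by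
    intro ξ
    have hS : 0 ≤ ∑ i, ‖𝓕 (gs i) ξ‖ := Finset.sum_nonneg fun i _ => norm_nonneg _
    rw [← pow_le_pow_iff_left₀ (norm_nonneg _) hS two_ne_zero, hfour ξ, sq, Finset.sum_mul]
    exact Finset.sum_le_sum fun i _ => by
      rw [sq]
      exact mul_le_mul_of_nonneg_left
        (Finset.single_le_sum (f := fun j => ‖𝓕 (gs j) ξ‖) (fun j _ => norm_nonneg _) (Finset.mem_univ i))
        (norm_nonneg _)
  have hmom : ∀ n : ℕ, Integrable (fun ξ : ℝ => ‖ξ‖ ^ n * ‖𝓕 f0 ξ‖) := by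
    intro n
    have hsum : Integrable (fun ξ : ℝ => ∑ i, ‖ξ‖ ^ n * ‖𝓕 (gs i) ξ‖) := by
      refine integrable_finsetSum _ fun i _ => ?_
      have hcoe : (((hgs_cs i).toSchwartzMap (hgs_smooth i) : 𝓢(ℝ, ℂ)) : ℝ → ℂ) = gs i := rfl
      have := ((𝓕 ((hgs_cs i).toSchwartzMap (hgs_smooth i))).integrable_pow_mul volume n)
      rw [fourier_coe, hcoe] at this
      exact this
    refine hsum.mono' ((continuous_norm.pow n).mul hF0cont.norm).aestronglyMeasurable
      (Eventually.of_forall fun ξ => ?_)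
    rw [Real.norm_eq_abs, abs_of_nonneg (by positivity), ← Finset.mul_sum]
    exact mul_le_mul_of_nonneg_left (hdom ξ) (by positivity)
  -- Step 3: the smooth representative and its support
  obtain ⟨f₁, hf₁smooth, hf₁ae⟩ := exists_contDiff_ae_eq_of_fourier_moments hf0int hmom
  have hf₁supp : tsupport f₁ ⊆ Icc 0 L := tsupport_subset_of_ae_eq hf₁smooth.continuous hf₁ae isClosed_Icc hsupp0
  have hf₁cs : HasCompactSupport f₁ := IsCompact.of_isClosed_subset isCompact_Icc (isClosed_tsupport _) hf₁supp
  have hf₁int : Integrable f₁ := hf₁smooth.continuous.integrable_of_hasCompactSupport hf₁cs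
  -- Step 4: the autocorrelation identity for `f₁` and the `gsᵢ` by Fourier uniqueness
  have hfour₁ : ∀ ξ, 𝓕 (acorr f₁) ξ = 𝓕 (fun x => ∑ i, (acorr (gs i)) x) ξ := by
    intro ξ
    rw [fourier_autocorr hf₁int, fourier_congr_ae hf₁ae, hfour ξ,
      fourier_finset_sum _ fun i _ => integrable_autocorr (hgs_int i), Complex.ofReal_sum]
    exact Finset.sum_congr rfl fun i _ => (fourier_autocorr (hgs_int i) ξ).symm
  have hae : acorr f₁ =ᵐ[volume] fun x => ∑ i, (acorr (gs i)) x :=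
    Literature.Analysis.Fourier.ae_eq_of_fourier_eq (integrable_autocorr hf₁int)
      (integrable_finsetSum _ fun i _ => integrable_autocorr (hgs_int i)) (funext hfour₁)
  have heq : acorr f₁ = fun x => ∑ i, (acorr (gs i)) x :=
    (Continuous.ae_eq_iff_eq volume (continuous_autocorr hf₁smooth.continuous hf₁cs)
      (continuous_finsetSum _ fun i _ => continuous_autocorr (hgs_cont i) (hgs_cs i))).mp hae
  -- Step 5: translate back
  refine ⟨fun x => f₁ (x - (-a)), hf₁smooth.comp (contDiff_id.sub contDiff_const),
    hf₁cs.comp_homeomorph (Homeomorph.subRight (-a)), ?_, ?_⟩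
  · refine closure_minimal (fun x hx => ?_) isClosed_Icc
    have hx' : x - (-a) ∈ tsupport f₁ := subset_tsupport _ hx
    have := hf₁supp hx'
    exact ⟨by linarith [this.1], by linarith [this.2]⟩
  · rw [autocorr_comp_sub f₁ (-a), heq]
    funext x
    exact Finset.sum_congr rfl fun i _ => congrFun (autocorr_comp_sub (g i) a) x

end Literature.Analysis.Fourier.BoasKac

end
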